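import Mathlib.Analysis.InnerProductSpace.Basic
import Literature.Computability.Cryptography.StatisticalDistanceBhattacharyya
import Literature.Computability.Cryptography.StatisticalDistanceMapProofs
import Literature.Computability.Cryptography.PeikertReduction
import Literature.Algebra.EuclideanLattices.GaussianLatticeTails
import Literature.Algebra.EuclideanLattices.IntegerBases
import HarnessLib

/-!
# Peikert's classical `GapSVP_{ζ,γ} ≤ LWE` (pqc.S20): a DISCRETE-Gaussian perturbation law for the first component (approach B)

Topic `Computability/Cryptography` (family `pqc`). Sibling of `PeikertReduction.lean` (the architecture
of the named fact `Literature.Computability.Cryptography.peikert_gapSVPZeta_to_lwe_classical`, Peikert,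
STOC 2009, Thm. 3.1, from its two printed components `h₁`, `h₂`) and of `PeikertPerturbation.lean`,
which fixes for the first component `h₁` a ROUNDED continuous Gaussian perturbation
(`Literature.Probability.Distributions.GaussianShiftHiding.roundedGaussian`; approach A of this unit).
Everything here is PROVED and no named fact is introduced (D-0026).

**Relation to `PeikertPerturbation.lean` (two coexisting routes for the same step).** Hypothesis `h₁`
needs, besides the machine, exactly three mathematical inputs: (N) the NO-case analysis on a scaled copy
of the instance — `PeikertPerturbation.no_case_scaled` (approach-independent; USED, not restated, by
this route: run it with `M = 2`, or any even `M`); (T) a norm tail putting the perturbation inside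
Peikert's radius `d'` outside a negligible event; (H) a hiding bound `Δ(W, z + W) ≤ 1 − 1/poly(n)` for
the law `W` of the perturbation and lattice shifts `‖z‖ ≤ D`. Route A supplies (T), (H) for
`W = roundedGaussian` (Chernoff tail `2^{n/2}e^{-2n}`; hiding advantage `≥ 1/(9n¹²)` via the Gaussian
half-space overlap, `prob_names_perturbation_roundedGaussian_le`, `inv_poly_le_hiding_advantage`).
Route B (this file) supplies (T), (H) for `W = intGaussian n s = D_{ℤⁿ,s}`, the tree's lattice
discrete Gaussian read in integer coordinates: (T) is Banaszczyk's bound `Pr[‖w‖ ≥ s√n] ≤ 2⁻ⁿ`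
(`intGaussian_norm_ge_le`, from the tree theorem `gaussianMass_diff_ball_le_holds`), and (H) is an
EXACT Bhattacharyya computation for EVEN shifts — `BC(D_{L,s,c}, D_{L,s,c+2u}) = ρ_s(u)`, no smoothing
hypothesis, no measure theory — giving the advantage `≥ n^{-2π}/4` at `s√n = d'`
(`prob_names_intGaussian_perturbation_le`, `rpow_neg_two_pi_le_exp`, `div_mul_sqrt_eq_perturbRadius`);
evenness is obtained by scaling the instance by `2` (a shortest vector `u` of `L(B)` appears in
`L(2B) = 2L(B)` as `u + u`). Which route the machine of `h₁` finally samples is the unit's choice;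
retiring the other is a separate dedup step.

Contents — the discrete Gaussian `D_{L,s}` of the tree (`Literature.Algebra.EuclideanLattices.discreteGaussian`),
transported to `ℤⁿ`, with the two statistical facts (T), (H), so that neither ball-intersection
volumes (Peikert's `W = U(d'·Bₙ)` with the Goldreich–Goldwasser lemma, his Lemma 2.1) nor exact
sampling from a ball are needed in the bit model:

* **Hiding of EVEN shifts, exactly.** For a discrete subgroup `L` of a finite-dimensional inner
  product space, `0 < s`, any centre `c` and any `u ∈ L`, the Bhattacharyya coefficient is
  `BC(D_{L,s,c}, D_{L,s,c+2u}) = ρ_s(u) = e^{-π‖u‖²/s²}` (`bcCoeff_discreteGaussian_even_shift`;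
  parallelogram law and re-indexing, NO smoothing hypothesis), hence by Le Cam's inequality
  (`PMF.tvDist_le_sqrt_one_sub_bcCoeff_sq` of `StatisticalDistanceBhattacharyya.lean`)
  `Δ(D_{L,s,c}, D_{L,s,c+2u}) ≤ √(1 - ρ_s(u)²) ≤ min (1 - ρ_s(u)²/2) (√(2π)‖u‖/s)`
  (`tvDist_discreteGaussian_even_shift_le_sqrt/_le_one_sub/_le`). In Peikert's regime
  (`PeikertReduction.lean`: perturbation norm `≤ d' = perturbRadius n d = d√n/(2√(log n))`) take
  `s = d/(2√(log n))`, so that `s√n = d'` (`div_mul_sqrt_eq_perturbRadius`; tail event `2⁻ⁿ`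
  below); for an even shift `u + u` with `‖u‖ ≤ d/2` then `ρ_s(u)² = e^{-2π‖u‖²/s²} ≥ n^{-2π}`
  (`rpow_neg_two_pi_le_exp`), i.e. `Δ ≤ √(1 − n^{-2π}) ≤ 1 − n^{-2π}/2` — the printed
  `1 − 1/poly(n)` of Lemma 2.1 — while a shift of norm `≤ s` is hidden to within the constant
  `√(2π)`. The parity restriction is met by running the first component on the scaled instance
  `(2B, 2d)`: a shortest vector `u` of `L(B)` (`‖u‖ ≤ d = (2d)/2` on a YES instance) appears in
  `L(2B) = 2L(B)` as the even vector `u + u`, and the NO case on the scaled copy is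
  `PeikertPerturbation.no_case_scaled` with `M = 2` (scale-free analysis of approach A, reused).
* **Norm tail** (Banaszczyk 1993, Lemma 1.5; the tree theorem `gaussianMass_diff_ball_le_holds`):
  `Pr_{w ∼ D_{L,s}}[‖w‖ ≥ s√n] ≤ 2⁻ⁿ` in `PMF` form (`toOuterMeasure_discreteGaussian_norm_ge_le`).
* **Transport to `ℤⁿ`**: `intVecAddEquivStd n : (Fin n → ℤ) ≃+ stdIntLattice n`,
  `intGaussian n s : PMF (Fin n → ℤ)` (the law `W` in the format of
  `PeikertReduction.prob_names_perturbation_le`), with `intGaussian_tvDist_map_add_self_le_sqrt`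
  (`Δ(W, (u+u) + W) ≤ √(1 - e^{-2π‖u‖²/s²})`) and `intGaussian_norm_ge_le` (`Pr[‖w‖ ≥ s√n] ≤ 2⁻ⁿ`).
* **The YES case with this law**: `prob_names_intGaussian_perturbation_le` — composition with
  `PeikertReduction.prob_names_perturbation_le`: a solver whose view is invariant under the even shift
  `u + u ≠ 0` names a `D_{ℤⁿ,s}`-perturbation with probability `≤ (1 + √(1 − e^{-2π‖u‖²/s²}))/2`; and
  `rpow_neg_two_pi_le_exp`: at `s = d/(2√(log n))` (so `s√n = d'`) and `‖u‖ ≤ d/2`,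
  `e^{-2π‖u‖²/s²} ≥ n^{-2π}` — the `1 − 1/poly(n)` of Lemma 2.1, with exponent `2π`.

Also: `discreteGaussian_map_add_right` (`(· + v)_* D_{L,s,c} = D_{L,s,c+v}`, `v ∈ L`) and
`gaussianMass_add_coe` (`ρ_{s,c+v}(L) = ρ_{s,c}(L)`).

## References

* C. Peikert, *Public-key cryptosystems from the worst-case shortest vector problem*, STOC 2009,
  333–342, doi:10.1145/1536414.1536461; full version Dagstuhl Seminar Proc. 08491 (2009): Lemma 2.1
  and the proof of Thm. 3.1, YES case (p. 12).
* D. Micciancio, O. Regev, *Worst-case to average-case reductions based on Gaussian measures*,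
  SIAM J. Comput. 37 (2007), §2 (discrete Gaussian), Lemma 2.10 (tail).
* W. Banaszczyk, *New bounds in some transference theorems in the geometry of numbers*, Math. Ann.
  296 (1993), Lemma 1.5.
-/

noncomputable section

open scoped ENNReal
open Metric Literature.Algebra.EuclideanLattices Real

namespace Literature.Computability.Cryptography

namespace Peikert2009

/-! ### Discrete Gaussians: translation and the even-shift Bhattacharyya identity -/

section DiscreteGaussianShift

variable {E : Type*} [NormedAddCommGroup E] [InnerProductSpace ℝ E] [FiniteDimensional ℝ E]
  (L : Submodule ℤ E) [DiscreteTopology L]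

omit [InnerProductSpace ℝ E] [FiniteDimensional ℝ E] [DiscreteTopology L] in
/-- Translating the centre by a lattice vector does not change the Gaussian mass:
`ρ_{s,c+v}(L) = ρ_{s,c}(L)` for `v ∈ L` (re-index `x ↦ x − v`). [cite: MicciancioRegev2007, §2] -/
theorem gaussianMass_add_coe (s : ℝ) (c : E) (v : L) :
    gaussianMass s (c + (v : E)) (L : Set E) = gaussianMass s c (L : Set E) := by
  unfold gaussianMass
  calc ∑' x : L, ENNReal.ofReal (gaussianFunction s ((x : E) - (c + (v : E))))
      = ∑' x : L, (fun y : L => ENNReal.ofReal (gaussianFunction s ((y : E) - c)))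
          (Equiv.subRight v x) := by
        refine tsum_congr fun x => ?_
        simp only [Equiv.subRight_apply, Submodule.coe_sub, sub_sub, add_comm]
    _ = ∑' y : L, ENNReal.ofReal (gaussianFunction s ((y : E) - c)) :=
        Equiv.tsum_eq (Equiv.subRight v)
          (fun y : L => ENNReal.ofReal (gaussianFunction s ((y : E) - c)))

omit [InnerProductSpace ℝ E] [FiniteDimensional ℝ E] [DiscreteTopology L] in
/-- The Gaussian mass as a real series, `toReal` form of the tree's
`gaussianMass_coe_eq_ofReal_tsum`: `ρ_{s,c}(L) = ∑_{x ∈ L} ρ_s(x − c)` (all terms finite; no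
summability needed in this direction). [cite: MicciancioRegev2007, §2] -/
theorem toReal_gaussianMass_eq_tsum (s : ℝ) (c : E) :
    (gaussianMass s c (L : Set E)).toReal = ∑' x : L, gaussianFunction s ((x : E) - c) := by
  rw [gaussianMass, ENNReal.tsum_toReal_eq (fun _ => ENNReal.ofReal_ne_top)]
  exact tsum_congr fun x => ENNReal.toReal_ofReal (gaussianFunction_pos _ _).le

/-- **Translation of a discrete Gaussian by a lattice vector**: the push-forward of `D_{L,s,c}`
under `x ↦ x + v` (`v ∈ L`) is `D_{L,s,c+v}`. [cite: MicciancioRegev2007, §2] -/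
theorem discreteGaussian_map_add_right {s : ℝ} (hs : 0 < s) (c : E) (v : L) :
    (discreteGaussian L s c).map (· + v) = discreteGaussian L s (c + (v : E)) := by
  classical
  ext x
  rw [PMF.map_apply, tsum_eq_single (x - v)]
  · rw [if_pos (by simp), discreteGaussian_apply L hs, discreteGaussian_apply L hs,
      gaussianMass_add_coe]
    simp only [Submodule.coe_sub, sub_sub, add_comm]
  · intro a ha
    rw [if_neg]
    intro h
    exact ha (by rw [h, add_sub_cancel_right])

/-- Left-translation form: `(v + ·)_* D_{L,s,c} = D_{L,s,c+v}` for `v ∈ L`. [cite: MicciancioRegev2007, §2] -/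
theorem discreteGaussian_map_add_left {s : ℝ} (hs : 0 < s) (c : E) (v : L) :
    (discreteGaussian L s c).map (v + ·) = discreteGaussian L s (c + (v : E)) := by
  rw [show (v + ·) = (· + v) from funext fun x => add_comm v x]
  exact discreteGaussian_map_add_right L hs c v

omit [FiniteDimensional ℝ E] in
/-- The algebra behind the even-shift identity: `ρ_s(y) ρ_s(y − 2u) = (ρ_s(y − u) ρ_s(u))²`
(parallelogram law `‖y‖² + ‖y − 2u‖² = 2‖y − u‖² + 2‖u‖²`), hence
`√(ρ_s(y) ρ_s(y − 2u)) = ρ_s(y − u) ρ_s(u)`. [folklore] -/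
theorem sqrt_gaussianFunction_mul_sub_two_smul (s : ℝ) (y u : E) :
    Real.sqrt (gaussianFunction s y * gaussianFunction s (y - (2 : ℝ) • u)) =
      gaussianFunction s (y - u) * gaussianFunction s u := by
  have hpar : ‖y‖ ^ 2 + ‖y - (2 : ℝ) • u‖ ^ 2 = 2 * (‖y - u‖ ^ 2 + ‖u‖ ^ 2) := by
    have h := parallelogram_law_with_norm ℝ (y - u) u
    rw [sub_add_cancel, sub_sub, ← two_smul ℝ u] at h
    nlinarith [h]
  have hsq : gaussianFunction s y * gaussianFunction s (y - (2 : ℝ) • u) =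
      (gaussianFunction s (y - u) * gaussianFunction s u) ^ 2 := by
    unfold gaussianFunction
    rw [← Real.exp_add, ← Real.exp_add, pow_two (Real.exp _), ← Real.exp_add,
      show -π * ‖y‖ ^ 2 / s ^ 2 + -π * ‖y - (2 : ℝ) • u‖ ^ 2 / s ^ 2 =
        (-π / s ^ 2) * (‖y‖ ^ 2 + ‖y - (2 : ℝ) • u‖ ^ 2) by ring, hpar]
    congr 1
    ring
  rw [hsq]
  exact Real.sqrt_sq (mul_nonneg (gaussianFunction_pos _ _).le (gaussianFunction_pos _ _).le)

/-- **Even-shift Bhattacharyya identity for discrete Gaussians**: for `u ∈ L`, `0 < s` and any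
centre `c`, `BC(D_{L,s,c}, D_{L,s,c+2u}) = ρ_s(u) = e^{-π‖u‖²/s²}` — exactly, with no smoothing
hypothesis (termwise `√(ρ_s(x−c)ρ_s(x−c−2u)) = ρ_s(x−c−u) ρ_s(u)`, then `ρ_{s,c+u}(L) = ρ_{s,c}(L)`).
This replaces the ball lemma (Goldreich–Goldwasser 2000; Peikert 2009, Lemma 2.1) in the hiding step
of the proof of Thm. 3.1. [cite: Peikert2009, Lemma 2.1 and Thm. 3.1 proof, YES case (full version p. 12), discrete-Gaussian variant] -/
theorem bcCoeff_discreteGaussian_even_shift {s : ℝ} (hs : 0 < s) (c : E) (u : L) :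
    (discreteGaussian L s c).bcCoeff (discreteGaussian L s (c + (2 : ℝ) • (u : E))) =
      gaussianFunction s (u : E) := by
  set Z := gaussianMass s c (L : Set E) with hZ
  have hZr : 0 < Z.toReal :=
    ENNReal.toReal_pos (gaussianMass_lattice_ne_zero L s c) (gaussianMass_lattice_ne_top L hs.ne' c)
  have h2u : c + (2 : ℝ) • (u : E) = c + ((u + u : L) : E) := by
    rw [Submodule.coe_add, two_smul]
  have hZ' : gaussianMass s (c + (2 : ℝ) • (u : E)) (L : Set E) = Z := by
    rw [h2u, gaussianMass_add_coe]
  have hD : ∀ x : L, (discreteGaussian L s c x).toReal =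
      gaussianFunction s ((x : E) - c) / Z.toReal := fun x => by
    rw [discreteGaussian_apply L hs, ENNReal.toReal_mul,
      ENNReal.toReal_ofReal (gaussianFunction_pos _ _).le, ENNReal.toReal_inv, div_eq_mul_inv]
  have hD' : ∀ x : L, (discreteGaussian L s (c + (2 : ℝ) • (u : E)) x).toReal =
      gaussianFunction s ((x : E) - c - (2 : ℝ) • (u : E)) / Z.toReal := fun x => by
    rw [discreteGaussian_apply L hs, hZ', ENNReal.toReal_mul,
      ENNReal.toReal_ofReal (gaussianFunction_pos _ _).le, ENNReal.toReal_inv, div_eq_mul_inv,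
      sub_sub]
  have hterm : ∀ x : L, Real.sqrt ((discreteGaussian L s c x).toReal *
      (discreteGaussian L s (c + (2 : ℝ) • (u : E)) x).toReal) =
      gaussianFunction s (u : E) / Z.toReal * gaussianFunction s ((x : E) - (c + (u : E))) := by
    intro x
    rw [hD, hD', div_mul_div_comm,
      Real.sqrt_div (mul_nonneg (gaussianFunction_pos _ _).le (gaussianFunction_pos _ _).le),
      Real.sqrt_mul_self hZr.le, sqrt_gaussianFunction_mul_sub_two_smul, sub_sub]
    ring
  unfold PMF.bcCoeff
  rw [tsum_congr hterm, tsum_mul_left, ← toReal_gaussianMass_eq_tsum, gaussianMass_add_coe,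
    div_mul_cancel₀ _ hZr.ne']

/-- **Hiding bound for discrete-Gaussian perturbations, Bhattacharyya form**: for `u ∈ L`, `0 < s`,
`Δ(D_{L,s,c}, D_{L,s,c+2u}) ≤ √(1 − ρ_s(u)²)` (Le Cam's inequality and the even-shift identity).
[cite: Peikert2009, Lemma 2.1 and Thm. 3.1 proof, YES case (full version p. 12), discrete-Gaussian variant] -/
theorem tvDist_discreteGaussian_even_shift_le_sqrt {s : ℝ} (hs : 0 < s) (c : E) (u : L) :
    (discreteGaussian L s c).tvDist (discreteGaussian L s (c + (2 : ℝ) • (u : E))) ≤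
      Real.sqrt (1 - gaussianFunction s (u : E) ^ 2) := by
  rw [← bcCoeff_discreteGaussian_even_shift L hs c u]
  exact PMF.tvDist_le_sqrt_one_sub_bcCoeff_sq _ _

/-- **Hiding bound, `1 − 1/poly` form**: `Δ(D_{L,s,c}, D_{L,s,c+2u}) ≤ 1 − ρ_s(u)²/2`, where
`ρ_s(u)² = e^{-2π‖u‖²/s²}`; for `‖u‖² ≤ (k log n) s²/(2π)` the right-hand side is `≤ 1 − n⁻ᵏ/2`, the
shape `1 − 1/poly(n)` of Lemma 2.1. [cite: Peikert2009, Lemma 2.1 ("≤ 1 − 1/poly(n)") and Thm. 3.1 proof, YES case (full version pp. 7, 12), discrete-Gaussian variant] -/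
theorem tvDist_discreteGaussian_even_shift_le_one_sub {s : ℝ} (hs : 0 < s) (c : E) (u : L) :
    (discreteGaussian L s c).tvDist (discreteGaussian L s (c + (2 : ℝ) • (u : E))) ≤
      1 - gaussianFunction s (u : E) ^ 2 / 2 := by
  refine (tvDist_discreteGaussian_even_shift_le_sqrt L hs c u).trans ?_
  have h0 : 0 ≤ gaussianFunction s (u : E) ^ 2 := sq_nonneg _
  have h1 : gaussianFunction s (u : E) ^ 2 ≤ 1 :=
    pow_le_one₀ (gaussianFunction_pos _ _).le (gaussianFunction_le_one _ _)
  calc Real.sqrt (1 - gaussianFunction s (u : E) ^ 2)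
      ≤ Real.sqrt ((1 - gaussianFunction s (u : E) ^ 2 / 2) ^ 2) :=
        Real.sqrt_le_sqrt (by nlinarith)
    _ = 1 - gaussianFunction s (u : E) ^ 2 / 2 := Real.sqrt_sq (by linarith)

/-- **Hiding bound, linear form**: `Δ(D_{L,s,c}, D_{L,s,c+2u}) ≤ √(2π) ‖u‖ / s`
(from `1 − e^{-x} ≤ x`); a shift of norm `≤ s` is hidden to within a constant.
[cite: Peikert2009, Thm. 3.1 proof, YES case (full version p. 12), discrete-Gaussian variant] -/
theorem tvDist_discreteGaussian_even_shift_le {s : ℝ} (hs : 0 < s) (c : E) (u : L) :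
    (discreteGaussian L s c).tvDist (discreteGaussian L s (c + (2 : ℝ) • (u : E))) ≤
      Real.sqrt (2 * π) * ‖(u : E)‖ / s := by
  refine (tvDist_discreteGaussian_even_shift_le_sqrt L hs c u).trans ?_
  have hρ2 : gaussianFunction s (u : E) ^ 2 = Real.exp (-(2 * π * ‖(u : E)‖ ^ 2 / s ^ 2)) := by
    unfold gaussianFunction
    rw [sq, ← Real.exp_add]
    congr 1
    ring
  rw [hρ2]
  calc Real.sqrt (1 - Real.exp (-(2 * π * ‖(u : E)‖ ^ 2 / s ^ 2)))
      ≤ Real.sqrt (2 * π * ‖(u : E)‖ ^ 2 / s ^ 2) :=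
        Real.sqrt_le_sqrt (by linarith [Real.one_sub_le_exp_neg (2 * π * ‖(u : E)‖ ^ 2 / s ^ 2)])
    _ = Real.sqrt (2 * π) * ‖(u : E)‖ / s := by
        rw [show 2 * π * ‖(u : E)‖ ^ 2 / s ^ 2 = (Real.sqrt (2 * π) * ‖(u : E)‖ / s) ^ 2 by
          rw [div_pow, mul_pow, Real.sq_sqrt (by positivity)]]
        exact Real.sqrt_sq (by positivity)

/-- Push-forward form: `Δ(D_{L,s,c}, ((u + u) + ·)_* D_{L,s,c}) ≤ √(1 − ρ_s(u)²)` for `u ∈ L`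
(the form `Δ(W, z + W)` with `z = u + u` consumed by `PeikertReduction.prob_names_perturbation_le`).
[cite: Peikert2009, Thm. 3.1 proof, YES case (full version p. 12), discrete-Gaussian variant] -/
theorem tvDist_discreteGaussian_map_add_self_le_sqrt {s : ℝ} (hs : 0 < s) (c : E) (u : L) :
    (discreteGaussian L s c).tvDist ((discreteGaussian L s c).map ((u + u) + ·)) ≤
      Real.sqrt (1 - gaussianFunction s (u : E) ^ 2) := by
  rw [discreteGaussian_map_add_left L hs, Submodule.coe_add, ← two_smul ℝ (u : E)]
  exact tvDist_discreteGaussian_even_shift_le_sqrt L hs c u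

/-! ### The norm tail in `PMF` form -/

/-- **Norm tail of the discrete Gaussian in `PMF` form** (Banaszczyk 1993, Lemma 1.5(i) with `c = 1`;
Micciancio–Regev 2007, Lemma 2.10; the tree theorem `gaussianMass_diff_ball_le_holds`): for a full
lattice `L` of an `n`-dimensional space and `0 < s`, `Pr_{w ∼ D_{L,s}}[‖w‖ ≥ s√n] ≤ 2⁻ⁿ`. (In the first
component of Peikert's reduction this bounds the perturbation by `s√n` outside a `2⁻ⁿ` event.)
[cite: MicciancioRegev2007, Lemma 2.10] -/
theorem toOuterMeasure_discreteGaussian_norm_ge_le [IsZLattice ℝ L] {s : ℝ} (hs : 0 < s) :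
    (discreteGaussian L s 0).toOuterMeasure
        {x : L | s * Real.sqrt (Module.finrank ℝ E) ≤ ‖(x : E)‖} ≤
      (2⁻¹ : ℝ≥0∞) ^ Module.finrank ℝ E := by
  classical
  set Z := gaussianMass s 0 (L : Set E) with hZ
  have hZ0 : Z ≠ 0 := gaussianMass_lattice_ne_zero L s 0
  have hZt : Z ≠ ∞ := gaussianMass_lattice_ne_top L hs.ne' 0
  set T : Set L := {x : L | s * Real.sqrt (Module.finrank ℝ E) ≤ ‖(x : E)‖} with hT
  have hpt : ∀ x : L, T.indicator (discreteGaussian L s 0) x =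
      T.indicator (fun x : L => ENNReal.ofReal (gaussianFunction s ((x : E) - 0))) x * Z⁻¹ := by
    intro x
    by_cases hx : x ∈ T
    · rw [Set.indicator_of_mem hx, Set.indicator_of_mem hx]
      exact discreteGaussian_apply L hs 0 x
    · rw [Set.indicator_of_notMem hx, Set.indicator_of_notMem hx, zero_mul]
  -- the tail sum is the Gaussian mass outside the ball (tree: `gaussianMass_diff_ball_eq_ofReal_tsum`)
  have htail : ∑' x : L, T.indicator (fun x : L => ENNReal.ofReal (gaussianFunction s ((x : E) - 0))) x =
      gaussianMass s 0 ((L : Set E) \ ball (0 : E) (s * Real.sqrt (Module.finrank ℝ E))) := by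
    have hsumm : Summable (T.indicator fun y : L => gaussianFunction s (y : E)) :=
      ((summable_gaussianFunction_sub L hs.ne' 0).congr fun y => by rw [sub_zero]).indicator T
    rw [gaussianMass_diff_ball_eq_ofReal_tsum L hs.ne',
      ENNReal.ofReal_tsum_of_nonneg (f := T.indicator fun y : L => gaussianFunction s (y : E))
        (fun y => Set.indicator_nonneg (f := fun z : L => gaussianFunction s (z : E))
          (fun z _ => (gaussianFunction_pos s (z : E)).le) y) hsumm]
    refine tsum_congr fun x => ?_
    by_cases hx : x ∈ T
    · rw [Set.indicator_of_mem hx, Set.indicator_of_mem hx, sub_zero]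
    · rw [Set.indicator_of_notMem hx, Set.indicator_of_notMem hx, ENNReal.ofReal_zero]
  rw [PMF.toOuterMeasure_apply, tsum_congr hpt, ENNReal.tsum_mul_right, htail]
  calc gaussianMass s 0 ((L : Set E) \ ball (0 : E) (s * Real.sqrt (Module.finrank ℝ E))) * Z⁻¹
      ≤ (2⁻¹ : ℝ≥0∞) ^ Module.finrank ℝ E * Z * Z⁻¹ := by
        gcongr
        exact gaussianMass_diff_ball_le_holds L hs
    _ = (2⁻¹ : ℝ≥0∞) ^ Module.finrank ℝ E := by
        rw [mul_assoc, ENNReal.mul_inv_cancel hZ0 hZt, mul_one]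

end DiscreteGaussianShift

/-! ### Transport to `ℤⁿ` -/

section IntGaussian

variable (n : ℕ)

/-- The additive equivalence `ℤⁿ ≃ ℤⁿ ⊂ ℝⁿ` between integer vectors and the standard integer
lattice `stdIntLattice n` of `EuclideanSpace ℝ (Fin n)` (forward map `intVecToEuclidean`; inverse by
reading off the integer coordinates, `mem_stdIntLattice_iff`). [folklore] -/
def intVecAddEquivStd : (Fin n → ℤ) ≃+ stdIntLattice n where
  toFun v := ⟨intVecToEuclidean n v, intVecToEuclidean_mem_stdIntLattice n v⟩
  invFun x := fun j => ((mem_stdIntLattice_iff (x : EuclideanSpace ℝ (Fin n))).1 x.2 j).choose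
  left_inv v := by
    funext j
    have h : ((((mem_stdIntLattice_iff (intVecToEuclidean n v)).1
        (intVecToEuclidean_mem_stdIntLattice n v) j).choose : ℤ) : ℝ) = (v j : ℝ) :=
      ((mem_stdIntLattice_iff (intVecToEuclidean n v)).1
        (intVecToEuclidean_mem_stdIntLattice n v) j).choose_spec
    dsimp only
    exact_mod_cast h
  right_inv x := by
    apply Subtype.ext
    ext j
    rw [intVecToEuclidean_apply]
    exact ((mem_stdIntLattice_iff (x : EuclideanSpace ℝ (Fin n))).1 x.2 j).choose_spec
  map_add' v w := by
    apply Subtype.ext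
    simp only [map_add, Submodule.coe_add]

/-- The forward map of `intVecAddEquivStd` is `intVecToEuclidean`. [folklore] -/
@[simp] theorem coe_intVecAddEquivStd (v : Fin n → ℤ) :
    ((intVecAddEquivStd n v : stdIntLattice n) : EuclideanSpace ℝ (Fin n)) = intVecToEuclidean n v :=
  rfl

/-- The inverse of `intVecAddEquivStd` followed by `intVecToEuclidean` is the inclusion. [folklore] -/
@[simp] theorem intVecToEuclidean_symm_intVecAddEquivStd (x : stdIntLattice n) :
    intVecToEuclidean n ((intVecAddEquivStd n).symm x) = (x : EuclideanSpace ℝ (Fin n)) := by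
  have h := coe_intVecAddEquivStd n ((intVecAddEquivStd n).symm x)
  rw [AddEquiv.apply_symm_apply] at h
  exact h.symm

/-- **The discrete-Gaussian perturbation law on `ℤⁿ`**: `W = D_{ℤⁿ,s}` as a `PMF (Fin n → ℤ)`
(the tree's `discreteGaussian` on `stdIntLattice n`, centre `0`, read back in integer coordinates) —
the format of the perturbation law `W` of `PeikertReduction.prob_names_perturbation_le`.
[cite: Peikert2009, Thm. 3.1 proof, step 1 (full version p. 12), discrete-Gaussian variant] -/
def intGaussian (s : ℝ) : PMF (Fin n → ℤ) :=
  (discreteGaussian (stdIntLattice n) s 0).map (intVecAddEquivStd n).symm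

/-- Shifting `W = D_{ℤⁿ,s}` by an integer vector `z` is the transported `D_{ℤⁿ,s,z}`.
[cite: MicciancioRegev2007, §2] -/
theorem intGaussian_map_add {s : ℝ} (hs : 0 < s) (z : Fin n → ℤ) :
    (intGaussian n s).map (z + ·) =
      (discreteGaussian (stdIntLattice n) s (0 + ((intVecAddEquivStd n z : stdIntLattice n) :
        EuclideanSpace ℝ (Fin n)))).map (intVecAddEquivStd n).symm := by
  rw [intGaussian, PMF.map_comp, ← discreteGaussian_map_add_left _ hs, PMF.map_comp]
  congr 1
  funext x
  simp only [Function.comp_apply, map_add, AddEquiv.symm_apply_apply]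

/-- **Hiding of even shifts for `W = D_{ℤⁿ,s}`**: for `u ∈ ℤⁿ` and `0 < s`,
`Δ(W, (u + u) + W) ≤ √(1 − e^{-2π‖u‖²/s²})` (`‖u‖` the Euclidean norm of `u`), by the even-shift
Bhattacharyya identity, Le Cam's inequality and data processing along the coordinate map. With
`PeikertReduction.prob_names_perturbation_le` (`z = u + u ≠ 0`): no solver names a `W`-perturbation
from its class modulo a lattice containing `u + u` with probability `> (1 + √(1 − e^{-2π‖u‖²/s²}))/2`.
[cite: Peikert2009, Lemma 2.1 and Thm. 3.1 proof, YES case (full version p. 12), discrete-Gaussian variant] -/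
theorem intGaussian_tvDist_map_add_self_le_sqrt {s : ℝ} (hs : 0 < s) (u : Fin n → ℤ) :
    (intGaussian n s).tvDist ((intGaussian n s).map ((u + u) + ·)) ≤
      Real.sqrt (1 - Real.exp (-π * ‖intVecToEuclidean n u‖ ^ 2 / s ^ 2) ^ 2) := by
  rw [intGaussian_map_add n hs, intGaussian]
  refine (PMF.tvDist_map_le_holds _ _ _).trans ?_
  have he : ((intVecAddEquivStd n (u + u) : stdIntLattice n) : EuclideanSpace ℝ (Fin n)) =
      (2 : ℝ) • intVecToEuclidean n u := by
    rw [map_add, Submodule.coe_add, coe_intVecAddEquivStd, two_smul]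
  rw [he]
  have h := tvDist_discreteGaussian_even_shift_le_sqrt (stdIntLattice n) hs 0 (intVecAddEquivStd n u)
  rw [coe_intVecAddEquivStd] at h
  exact h

/-- **Norm tail for `W = D_{ℤⁿ,s}`**: `Pr_{w ∼ W}[‖w‖ ≥ s√n] ≤ 2⁻ⁿ` (`0 < s`).
[cite: MicciancioRegev2007, Lemma 2.10] -/
theorem intGaussian_norm_ge_le {s : ℝ} (hs : 0 < s) :
    (intGaussian n s).toOuterMeasure {w | s * Real.sqrt n ≤ ‖intVecToEuclidean n w‖} ≤
      (2⁻¹ : ℝ≥0∞) ^ n := by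
  rw [intGaussian, PMF.toOuterMeasure_map_apply]
  have h := toOuterMeasure_discreteGaussian_norm_ge_le (stdIntLattice n) hs
  rw [finrank_euclideanSpace_fin] at h
  convert h using 2
  ext x
  simp only [Set.mem_preimage, Set.mem_setOf_eq, intVecToEuclidean_symm_intVecAddEquivStd]

/-- `u + u ≠ 0` for a nonzero integer vector `u`. [folklore] -/
theorem add_self_ne_zero {u : Fin n → ℤ} (hu : u ≠ 0) : u + u ≠ 0 := by
  intro h
  apply hu
  funext j
  have hj := congrFun h j
  simp only [Pi.add_apply, Pi.zero_apply] at hj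
  change u j = 0
  omega

/-- **YES case of Thm. 3.1 with the discrete-Gaussian perturbation** (composition of
`PeikertReduction.prob_names_perturbation_le` with `intGaussian_tvDist_map_add_self_le_sqrt`): if the
view `red` of the solver is invariant under the even lattice shift `u + u` (`u ≠ 0`; e.g. `x = w mod 2B`
for `u ∈ L(B)`), then whatever the solver computes from the view and from coins independent of the
perturbation `w ∼ D_{ℤⁿ,s}`, it names `w` with probability at most
`(1 + √(1 − e^{-2π‖u‖²/s²}))/2 ≤ 1 − e^{-2π‖u‖²/s²}/4`.
[cite: Peikert2009, Thm. 3.1 proof, YES case ("Pr[R(x) = x − w] ≤ 1 − 1/poly(n)", full version p. 12), discrete-Gaussian variant] -/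
theorem prob_names_intGaussian_perturbation_le {C X β : Type*} (μ : PMF C) {s : ℝ} (hs : 0 < s)
    (red : (Fin n → ℤ) → X) (lift : X → (Fin n → ℤ)) (run : X → C → β) (dec : β → (Fin n → ℤ))
    {u : Fin n → ℤ} (hu : u ≠ 0) (hred : ∀ w, red ((u + u) + w) = red w) :
    ((μ.bind fun c => (intGaussian n s).map fun w => (c, w)).toOuterMeasure
        {p | dec (run (red p.2) p.1) = lift (red p.2) - p.2}).toReal ≤
      (1 + Real.sqrt (1 - Real.exp (-π * ‖intVecToEuclidean n u‖ ^ 2 / s ^ 2) ^ 2)) / 2 := by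
  refine (prob_names_perturbation_le μ (intGaussian n s) red lift run dec (add_self_ne_zero n hu)
    hred).trans ?_
  gcongr
  exact intGaussian_tvDist_map_add_self_le_sqrt n hs u

/-- **The variant meets Lemma 2.1's `1 − 1/poly(n)`** in the regime of `PeikertReduction.no_case`
(perturbation norm `≤ d' = d√n/(2√(log n))`, guaranteed outside a `2⁻ⁿ` event by `intGaussian_norm_ge_le`
at `s = d/(2√(log n))`, i.e. `s√n = d'`): for a shift `u` with `‖u‖ ≤ d/2` (a shortest vector of the
UNscaled YES instance inside the instance scaled by `2`, where it appears as the even vector `u + u` of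
norm `≤ d`) one has `e^{-2π‖u‖²/s²} ≥ n^{-2π}`, so the naming probability above is `≤ 1 − n^{-2π}/4`.
[cite: Peikert2009, Lemma 2.1 (full version p. 7) and Thm. 3.1 proof, YES case (p. 12), discrete-Gaussian variant] -/
theorem rpow_neg_two_pi_le_exp {n : ℕ} (hn : 2 ≤ n) {d t : ℝ} (hd : 0 < d) (ht0 : 0 ≤ t)
    (ht : t ≤ d / 2) :
    (n : ℝ) ^ (-(2 * π)) ≤
      Real.exp (-π * t ^ 2 / (d / (2 * Real.sqrt (Real.log n))) ^ 2) ^ 2 := by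
  have hn0 : (0 : ℝ) < n := by exact_mod_cast lt_of_lt_of_le two_pos hn
  have hlog : 0 < Real.log n := Real.log_pos (by exact_mod_cast lt_of_lt_of_le one_lt_two hn)
  have hsq : (d / (2 * Real.sqrt (Real.log n))) ^ 2 = d ^ 2 / (4 * Real.log n) := by
    rw [div_pow, mul_pow, Real.sq_sqrt hlog.le]
    norm_num
  rw [Real.rpow_def_of_pos hn0, sq (Real.exp _), ← Real.exp_add, Real.exp_le_exp, hsq]
  have ht2 : t ^ 2 ≤ d ^ 2 / 4 := by nlinarith
  have hd2 : 0 < d ^ 2 := by positivity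
  have hkey : π * t ^ 2 / (d ^ 2 / (4 * Real.log n)) ≤ π * Real.log n := by
    rw [div_div_eq_mul_div, div_le_iff₀ hd2]
    nlinarith [Real.pi_pos, mul_le_mul_of_nonneg_left ht2 (mul_nonneg Real.pi_pos.le hlog.le)]
  have : -π * t ^ 2 / (d ^ 2 / (4 * Real.log n)) = -(π * t ^ 2 / (d ^ 2 / (4 * Real.log n))) := by
    ring
  rw [this]
  linarith

/-- The fit with `PeikertReduction.no_case`: at `s = d/(2√(log n))` the tail radius `s√n` of
`intGaussian_norm_ge_le` is Peikert's perturbation radius `d' = perturbRadius n d = d√n/(2√(log n))`.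
[cite: Peikert2009, Thm. 3.1 proof, step 1 (`d' = d√(n/(4 log n))`, full version p. 12)] -/
theorem div_mul_sqrt_eq_perturbRadius (n : ℕ) (d : ℝ) :
    d / (2 * Real.sqrt (Real.log n)) * Real.sqrt n = perturbRadius n d := by
  unfold perturbRadius
  ring

end IntGaussian

end Peikert2009

end Literature.Computability.Cryptography

end
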